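import Summits.ValiantsHypothesis.ValiantsHypothesis.Theses.FeketeSOS

/-!
# `FeketeNoSparseSplit` (crux stmt-ValiantsHypothesis-3997): the lever CHARACTERISES the Legendre symbol — `±χ_p` are
the only `±1` patterns reaching order `(p-1)/2` at `1` mod `p` — and the DISTANCE LAW (cdisprove cycle 3, part 2 of 3)

Negative-side boundary facts (refuter-cdisprove-stmt-ValiantsHypothesis-3997-g3-0), PROVED, no new facts; companion of
`LeverCeiling.lean` (`ord₁ ≤ (p-1)/2` for every `±1` pattern) and `LeverExactOrder.lean` (`F̄_p` attains it).
`legendre_of_half_le_rootMultiplicity`: if `ε : [0,p) → {0, ±1} ⊂ 𝔽_p`, `ε(0) = 0`, `ε(m) = ±1` for `1 ≤ m < p`, and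
`(X-1)^{(p-1)/2} ∣ Σ_{m<p} ε(m) X^m` in `𝔽_p[X]` (`p` odd), then `ε = χ_p` or `ε = -χ_p` pointwise.  So among the
`2^{p-1}` sign patterns the char-`p` multiplicity lever reaches its ceiling at EXACTLY two, `±χ_p`: the line's method
applies to the Fekete polynomial and to no other `±1`-polynomial on `[1, p-1]` — zero slack
(`not_half_dvd_of_ne_legendre`).  Proof (elementary): (1) `(X-1)^k ∣ E` forces the power moments
`Σ_m ε(m) m^j = 0` for `j < k` (`sum_mul_pow_eq_zero_of_pow_dvd`: apply `X·d/dX` repeatedly — each application costs one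
factor `X-1`, and `((X d/dX)^j E)(1) = Σ ε(m) m^j`); (2) the interpolating polynomial `P(x) = Σ_m ε(m)(1 - (x-m)^{p-1})`
has `P(m) = ε(m)` and coefficients `P_i = ∓binom(p-1,i)·Σ_m ε(m) m^{p-1-i}` (`i ≥ 1`), so the moments kill every `P_i`
with `i > (p-1)/2`; (3) `P² - x^{p-1}` has degree `≤ p-1` and vanishes on all of `𝔽_p`, hence is `0`; (4) `P = ±x^{(p-1)/2}`
in the domain `𝔽_p[x]`, i.e. `ε = ±χ_p` by Euler's criterion (`legendreSym.eq_pow`).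
DISTANCE LAW `not_pow_dvd_of_close_to_legendre` (and `…_neg_legendre`; the Aly–Winterhof `k`-error argument,
Des. Codes Cryptogr. 40 (2006) 369–374, doi:10.1007/s10623-006-0023-5): if an ARBITRARY `ε : [0,p) → 𝔽_p` agrees with
`χ_p` in `≥ p-k` positions but not in all, `1 ≤ k ≤ (p-1)/2`, then `(X-1)^k ∤ Σ ε(m) X^m` — after `k` coefficient changes
the certificate of the line is `≤ k+1` (it was `(p+3)/2`), whereas the true minimum support-sum stays `≈ p` (exhaustively
`= p` for every single sign flip at `p = 11, 13, 17`).  Dictionary: `ord₁ E = p - L(ε)`, `L` = `𝔽_p`-linear complexity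
of the `p`-periodic sequence `ε`; stub 2 of the line is "`L(χ_p) = (p+1)/2`".
-/

namespace Summit.ValiantsHypothesis.Theorems.FeketeNoSparseSplit.Negative

open Polynomial Finset

section Extremiser

variable {R : Type*} [CommRing R]

/-- The Euler operator `X·d/dX` on a monomial sum multiplies the `m`-th coefficient by `m`. -/
theorem X_mul_derivative_sum_C_mul_X_pow (c : ℕ → R) (n : ℕ) :
    X * derivative (∑ m ∈ range n, C (c m) * X ^ m) = ∑ m ∈ range n, C (c m * m) * X ^ m := by
  rw [derivative_sum, Finset.mul_sum]
  refine Finset.sum_congr rfl fun m _ => ?_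
  rw [derivative_C_mul_X_pow]
  cases m with
  | zero => simp
  | succ k =>
    rw [Nat.add_sub_cancel, pow_succ]
    push_cast
    ring

/-- Iterating `X·d/dX` `j` times multiplies the `m`-th coefficient by `m^j`. -/
theorem iterate_X_mul_derivative_sum_C_mul_X_pow (c : ℕ → R) (n j : ℕ) :
    (fun F : R[X] => X * derivative F)^[j] (∑ m ∈ range n, C (c m) * X ^ m) =
      ∑ m ∈ range n, C (c m * (m : R) ^ j) * X ^ m := by
  induction j with
  | zero => simp
  | succ j ih =>
    rw [Function.iterate_succ_apply', ih, X_mul_derivative_sum_C_mul_X_pow]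
    refine Finset.sum_congr rfl fun m _ => ?_
    rw [pow_succ, mul_assoc]

/-- One application of `X·d/dX` costs at most one factor `X - 1`. -/
theorem X_sub_C_pow_dvd_X_mul_derivative (F : R[X]) (k : ℕ) (h : (X - C (1 : R)) ^ (k + 1) ∣ F) :
    (X - C (1 : R)) ^ k ∣ X * derivative F := by
  obtain ⟨G, rfl⟩ := h
  rw [derivative_mul, derivative_pow, derivative_X_sub_C, mul_one, Nat.add_sub_cancel]
  refine Dvd.dvd.mul_left (dvd_add ?_ ?_) _
  · exact ⟨C ((k + 1 : ℕ) : R) * G, by ring⟩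
  · rw [pow_succ]
    exact ⟨(X - C (1 : R)) * derivative G, by ring⟩

/-- `(X-1)^k ∣ F` implies `(X-1)^{k-j} ∣ (X·d/dX)^j F` for `j ≤ k`. -/
theorem X_sub_C_pow_dvd_iterate (F : R[X]) (k : ℕ) (h : (X - C (1 : R)) ^ k ∣ F) :
    ∀ j, j ≤ k → (X - C (1 : R)) ^ (k - j) ∣ (fun F : R[X] => X * derivative F)^[j] F := by
  intro j
  induction j with
  | zero => intro _; simpa using h
  | succ j ih =>
    intro hj
    rw [Function.iterate_succ_apply']
    refine X_sub_C_pow_dvd_X_mul_derivative _ _ ?_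
    have := ih (by omega)
    rwa [show k - j = k - (j + 1) + 1 by omega] at this

/-- **Moment vanishing**: `(X-1)^k ∣ Σ_{m<n} c(m) X^m` forces `Σ_{m<n} c(m)·m^j = 0` for every `j < k`. [folklore] -/
theorem sum_mul_pow_eq_zero_of_pow_dvd (c : ℕ → R) (n k : ℕ)
    (h : (X - C (1 : R)) ^ k ∣ ∑ m ∈ range n, C (c m) * X ^ m) (j : ℕ) (hj : j < k) :
    ∑ m ∈ range n, c m * (m : R) ^ j = 0 := by
  have hdvd := X_sub_C_pow_dvd_iterate _ k h j hj.le
  rw [iterate_X_mul_derivative_sum_C_mul_X_pow] at hdvd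
  have h1 : (X - C (1 : R)) ∣ ∑ m ∈ range n, C (c m * (m : R) ^ j) * X ^ m :=
    (dvd_pow_self _ (by omega : k - j ≠ 0)).trans hdvd
  rw [dvd_iff_isRoot, IsRoot, eval_finsetSum] at h1
  simpa [eval_mul, eval_C, eval_pow, eval_X] using h1

variable (p : ℕ) [Fact p.Prime]

/-- The interpolating polynomial `P(x) = Σ_{m<p} ε(m)·(1 - (x - m)^{p-1})` of a function `ε` on `𝔽_p` satisfies
`P(m') = ε(m')` for `m' < p` (Fermat: `(m' - m)^{p-1} = [m ≠ m']`). -/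
theorem eval_interp (ε : ℕ → ZMod p) (m' : ℕ) (hm' : m' < p) :
    (∑ m ∈ range p, C (ε m) * (1 - (X - C (m : ZMod p)) ^ (p - 1))).eval (m' : ZMod p) = ε m' := by
  have hprime : p.Prime := Fact.out
  rw [eval_finsetSum, Finset.sum_eq_single m']
  · have hp1 : p - 1 ≠ 0 := by have := hprime.two_le; omega
    simp [eval_mul, eval_C, eval_sub, eval_one, eval_pow, eval_X, zero_pow hp1]
  · intro m hm hne
    rw [Finset.mem_range] at hm
    have hne' : ((m' : ZMod p) - (m : ZMod p)) ≠ 0 := by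
      intro h
      rw [sub_eq_zero, ZMod.natCast_eq_natCast_iff', Nat.mod_eq_of_lt hm', Nat.mod_eq_of_lt hm] at h
      exact hne h.symm
    simp [eval_mul, eval_C, eval_sub, eval_one, eval_pow, eval_X, ZMod.pow_card_sub_one_eq_one hne']
  · intro h
    exact absurd (Finset.mem_range.mpr hm') h

/-- The coefficients of `P` above degree `0` are signed binomial multiples of the power moments:
`P_i = -binom(p-1, i)·(-1)^{p-1-i}·Σ_m ε(m) m^{p-1-i}` for `i ≥ 1`. -/
theorem coeff_interp (ε : ℕ → ZMod p) (i : ℕ) (hi : 1 ≤ i) :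
    (∑ m ∈ range p, C (ε m) * (1 - (X - C (m : ZMod p)) ^ (p - 1))).coeff i =
      -(((p - 1).choose i : ZMod p) * (-1) ^ (p - 1 - i)) * ∑ m ∈ range p, ε m * (m : ZMod p) ^ (p - 1 - i) := by
  rw [finsetSum_coeff, Finset.mul_sum]
  refine Finset.sum_congr rfl fun m _ => ?_
  rw [mul_sub, mul_one, coeff_sub, coeff_C, if_neg (by omega), zero_sub, coeff_C_mul,
    show (X - C (m : ZMod p)) = X + C (-(m : ZMod p)) by rw [map_neg, sub_eq_add_neg], coeff_X_add_C_pow, neg_pow]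
  ring

/-- If the power moments `Σ ε(m) m^j` vanish for all `j < h`, where `p - 1 ≤ 2h`, then `deg P ≤ h`. -/
theorem natDegree_interp_le (ε : ℕ → ZMod p) (h : ℕ) (h2 : p - 1 ≤ 2 * h) (h1 : 1 ≤ h)
    (hmom : ∀ j, j < h → ∑ m ∈ range p, ε m * (m : ZMod p) ^ j = 0) :
    (∑ m ∈ range p, C (ε m) * (1 - (X - C (m : ZMod p)) ^ (p - 1))).natDegree ≤ h := by
  rw [natDegree_le_iff_coeff_eq_zero]
  intro i hi
  have hi' : h < i := by exact_mod_cast hi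
  rw [coeff_interp p ε i (by omega), hmom (p - 1 - i) (by omega), mul_zero]

/-- **The lever characterises the Legendre symbol.**  For an odd prime `p` and `ε : ℕ → 𝔽_p` with `ε(0) = 0` and
`ε(m) = ±1` for `1 ≤ m < p`: if `(X - 1)^{(p-1)/2}` divides `Σ_{m<p} ε(m) X^m` in `𝔽_p[X]`, then `ε = χ_p` on `[0, p)`
or `ε = -χ_p` on `[0, p)`.  With `LeverCeiling.rootMultiplicity_one_le_half_of_unimodular` (order `≤ (p-1)/2` always):
the multiplicity lever attains its ceiling at exactly the two patterns `±χ_p`. [folklore] -/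
theorem legendre_of_half_le_rootMultiplicity (hp : p ≠ 2) (ε : ℕ → ZMod p) (h0 : ε 0 = 0)
    (hε : ∀ m, 1 ≤ m → m < p → ε m = 1 ∨ ε m = -1)
    (hdvd : (X - C (1 : ZMod p)) ^ ((p - 1) / 2) ∣ ∑ m ∈ range p, C (ε m) * X ^ m) :
    (∀ m, m < p → ε m = (legendreSym p m : ZMod p)) ∨ (∀ m, m < p → ε m = -(legendreSym p m : ZMod p)) := by
  have hprime : p.Prime := Fact.out
  obtain ⟨h, hh⟩ : ∃ h, p = 2 * h + 1 := hprime.eq_two_or_odd'.resolve_left hp |>.imp fun h hh => by omega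
  have hhalf : (p - 1) / 2 = h := by omega
  have hdiv2 : p / 2 = h := by omega
  have h1 : 1 ≤ h := by
    rcases Nat.lt_or_ge h 1 with hlt | hge
    · exfalso; have : p = 1 := by omega
      exact hprime.one_lt.ne' this
    · exact hge
  rw [hhalf] at hdvd
  -- (1) moments vanish below h
  have hmom : ∀ j, j < h → ∑ m ∈ range p, ε m * (m : ZMod p) ^ j = 0 :=
    fun j hj => sum_mul_pow_eq_zero_of_pow_dvd ε p h hdvd j hj
  -- (2) the interpolant has degree ≤ h
  set P : (ZMod p)[X] := (∑ m ∈ range p, C (ε m) * (1 - (X - C (m : ZMod p)) ^ (p - 1))) with hP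
  have hdegP : P.natDegree ≤ h := natDegree_interp_le p ε h (by omega) h1 hmom
  -- (3) P² - X^{p-1} vanishes identically
  have hQ : P ^ 2 - X ^ (p - 1) = 0 := by
    refine eq_zero_of_natDegree_lt_card_of_eval_eq_zero _ (f := (id : ZMod p → ZMod p))
      Function.injective_id ?_ ?_
    · intro x
      have hx : x = ((x.val : ℕ) : ZMod p) := (ZMod.natCast_zmod_val x).symm
      have hxlt : x.val < p := x.val_lt
      rw [id, eval_sub, eval_pow, eval_pow, eval_X, hx, eval_interp p ε _ hxlt]
      by_cases hx0 : x.val = 0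
      · rw [hx0, h0, Nat.cast_zero, zero_pow two_ne_zero, zero_pow (by omega), sub_zero]
      · have hne : ((x.val : ℕ) : ZMod p) ≠ 0 := by
          rw [Ne, ZMod.natCast_eq_zero_iff]; exact Nat.not_dvd_of_pos_of_lt (by omega) hxlt
        rw [ZMod.pow_card_sub_one_eq_one hne]
        rcases hε x.val (by omega) hxlt with h' | h' <;> rw [h'] <;> ring
    · have hdeg2 : (P ^ 2).natDegree ≤ p - 1 := natDegree_pow_le.trans (by omega)
      have hdegX : ((X : (ZMod p)[X]) ^ (p - 1)).natDegree ≤ p - 1 := (natDegree_X_pow _).le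
      have := natDegree_sub_le_of_le hdeg2 hdegX
      rw [ZMod.card]
      omega
  -- (4) P = ± X^h
  have hsq : P ^ 2 = (X ^ h) ^ 2 := by
    rw [← pow_mul, show h * 2 = p - 1 by omega]; exact sub_eq_zero.mp hQ
  have heuler : ∀ m : ℕ, (legendreSym p m : ZMod p) = (m : ZMod p) ^ h := by
    intro m
    rw [legendreSym.eq_pow, hdiv2, Int.cast_natCast]
  rcases sq_eq_sq_iff_eq_or_eq_neg.mp hsq with hPX | hPX
  · left
    intro m hm
    rw [← eval_interp p ε m hm, ← hP, hPX, eval_pow, eval_X, heuler]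
  · right
    intro m hm
    rw [← eval_interp p ε m hm, ← hP, hPX, eval_neg, eval_pow, eval_X, heuler]

/-- **Strictness away from `±χ_p`**: a `±1` pattern on `[1, p-1]` (with `ε(0) = 0`) that differs from `χ_p` somewhere
and from `-χ_p` somewhere has `(X-1)^{(p-1)/2} ∤ Σ ε(m) X^m`, i.e. order at `1` STRICTLY below the Legendre value
`(p-1)/2` — the certificate `ord₁ + 2` of the line is then `< (p+3)/2`. -/
theorem not_half_dvd_of_ne_legendre (hp : p ≠ 2) (ε : ℕ → ZMod p) (h0 : ε 0 = 0)
    (hε : ∀ m, 1 ≤ m → m < p → ε m = 1 ∨ ε m = -1)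
    (m₁ : ℕ) (hm₁ : m₁ < p) (hne₁ : ε m₁ ≠ (legendreSym p m₁ : ZMod p))
    (m₂ : ℕ) (hm₂ : m₂ < p) (hne₂ : ε m₂ ≠ -(legendreSym p m₂ : ZMod p)) :
    ¬ (X - C (1 : ZMod p)) ^ ((p - 1) / 2) ∣ ∑ m ∈ range p, C (ε m) * X ^ m := by
  intro hdvd
  rcases legendre_of_half_le_rootMultiplicity p hp ε h0 hε hdvd with H | H
  · exact hne₁ (H m₁ hm₁)
  · exact hne₂ (H m₂ hm₂)

/-- General degree bound: if the power moments `Σ ε(m) m^j` vanish for all `j < L` (`L ≥ 1`), then `deg P ≤ p - 1 - L`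
— the dictionary "`ord₁ ≥ L` ⟹ `ε` is a polynomial function on `𝔽_p` of degree `≤ p - 1 - L`" (equivalently: the
`𝔽_p`-linear complexity of the `p`-periodic sequence `ε` is `p - ord₁`; cf. Aly–Winterhof, Des. Codes Cryptogr. 40
(2006), doi:10.1007/s10623-006-0023-5, for the Legendre sequence). -/
theorem natDegree_interp_le_sub (ε : ℕ → ZMod p) (L : ℕ) (hL : 1 ≤ L)
    (hmom : ∀ j, j < L → ∑ m ∈ range p, ε m * (m : ZMod p) ^ j = 0) :
    (∑ m ∈ range p, C (ε m) * (1 - (X - C (m : ZMod p)) ^ (p - 1))).natDegree ≤ p - 1 - L := by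
  rw [natDegree_le_iff_coeff_eq_zero]
  intro i hi
  have hi' : p - 1 - L < i := by exact_mod_cast hi
  rw [coeff_interp p ε i (by omega), hmom (p - 1 - i) (by omega), mul_zero]

/-- **The distance law (quantitative fragility of the certificate).**  Let `ε : [0, p) → 𝔽_p` be ANY coefficient
sequence (no `±1` hypothesis) that agrees with `χ_p` at `≥ p - k` of the `p` positions but not everywhere, where
`1 ≤ k ≤ (p-1)/2`.  Then `(X-1)^k ∤ Σ_{m<p} ε(m) X^m` in `𝔽_p[X]`: after `k` arbitrary changes to the coefficients of
`F_p` the char-`p` multiplicity certificate is at most `(k-1) + 2 = k + 1`.  (`k = 1`: one changed coefficient ⟹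
`ord₁ = 0`, cf. `LeverCeiling.rootMultiplicity_one_flip_eq_zero`; the Aly–Winterhof `k`-error argument: `ord₁ ≥ k`
makes `ε` a polynomial function of degree `≤ p-1-k`, which then agrees with the degree-`(p-1)/2` function `m^{(p-1)/2}`
at `≥ p-k > p-1-k` points, so they coincide.) [folklore] -/
theorem not_pow_dvd_of_close_to_legendre (hp : p ≠ 2) (ε : ℕ → ZMod p) (k : ℕ) (hk1 : 1 ≤ k)
    (hk : k ≤ (p - 1) / 2)
    (hclose : p - k ≤ ((range p).filter (fun m => ε m = (legendreSym p m : ZMod p))).card)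
    (m₁ : ℕ) (hm₁ : m₁ < p) (hne : ε m₁ ≠ (legendreSym p m₁ : ZMod p)) :
    ¬ (X - C (1 : ZMod p)) ^ k ∣ ∑ m ∈ range p, C (ε m) * X ^ m := by
  have hprime : p.Prime := Fact.out
  obtain ⟨h, hh⟩ : ∃ h, p = 2 * h + 1 := hprime.eq_two_or_odd'.resolve_left hp |>.imp fun h hh => by omega
  have hdiv2 : p / 2 = h := by omega
  have heuler : ∀ m : ℕ, (legendreSym p m : ZMod p) = (m : ZMod p) ^ h := by
    intro m
    rw [legendreSym.eq_pow, hdiv2, Int.cast_natCast]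
  intro hdvd
  -- moments vanish below k, so the interpolant has degree ≤ p - 1 - k
  have hmom : ∀ j, j < k → ∑ m ∈ range p, ε m * (m : ZMod p) ^ j = 0 :=
    fun j hj => sum_mul_pow_eq_zero_of_pow_dvd ε p k hdvd j hj
  set P : (ZMod p)[X] := (∑ m ∈ range p, C (ε m) * (1 - (X - C (m : ZMod p)) ^ (p - 1))) with hP
  have hdegP : P.natDegree ≤ p - 1 - k := natDegree_interp_le_sub p ε k hk1 hmom
  -- R := P - X^h vanishes wherever ε agrees with χ_p
  set R : (ZMod p)[X] := P - X ^ h with hR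
  have hdegR : R.natDegree ≤ p - 1 - k := by
    have hX : ((X : (ZMod p)[X]) ^ h).natDegree ≤ p - 1 - k := by
      rw [natDegree_X_pow]; omega
    exact (natDegree_sub_le_of_le hdegP hX).trans (max_le le_rfl le_rfl)
  set S := (range p).filter (fun m => ε m = (legendreSym p m : ZMod p)) with hS
  have hinj : Set.InjOn (fun m : ℕ => (m : ZMod p)) (S : Set ℕ) := by
    intro a ha b hb hab
    have ha' : a < p := by
      have : a ∈ S := ha
      rw [hS, Finset.mem_filter, Finset.mem_range] at this; exact this.1
    have hb' : b < p := by
      have : b ∈ S := hb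
      rw [hS, Finset.mem_filter, Finset.mem_range] at this; exact this.1
    have := hab
    simp only at this
    rw [ZMod.natCast_eq_natCast_iff', Nat.mod_eq_of_lt ha', Nat.mod_eq_of_lt hb'] at this
    exact this
  have hR0 : R = 0 := by
    refine eq_zero_of_natDegree_lt_card_of_eval_eq_zero' R (S.image fun m : ℕ => (m : ZMod p)) ?_ ?_
    · intro x hx
      rw [Finset.mem_image] at hx
      obtain ⟨m, hm, rfl⟩ := hx
      rw [hS, Finset.mem_filter, Finset.mem_range] at hm
      rw [hR, eval_sub, eval_pow, eval_X, hP, eval_interp p ε m hm.1, hm.2, heuler, sub_self]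
    · rw [Finset.card_image_of_injOn hinj]
      omega
  -- hence P = X^h and ε agrees with χ_p everywhere, contradicting m₁
  have hPX : P = X ^ h := sub_eq_zero.mp hR0
  apply hne
  rw [← eval_interp p ε m₁ hm₁, ← hP, hPX, eval_pow, eval_X, heuler]

/-- The distance law towards `-χ_p` (apply the previous theorem to `-ε`). -/
theorem not_pow_dvd_of_close_to_neg_legendre (hp : p ≠ 2) (ε : ℕ → ZMod p) (k : ℕ) (hk1 : 1 ≤ k)
    (hk : k ≤ (p - 1) / 2)
    (hclose : p - k ≤ ((range p).filter (fun m => ε m = -(legendreSym p m : ZMod p))).card)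
    (m₁ : ℕ) (hm₁ : m₁ < p) (hne : ε m₁ ≠ -(legendreSym p m₁ : ZMod p)) :
    ¬ (X - C (1 : ZMod p)) ^ k ∣ ∑ m ∈ range p, C (ε m) * X ^ m := by
  intro hdvd
  refine not_pow_dvd_of_close_to_legendre p hp (fun m => -ε m) k hk1 hk ?_ m₁ hm₁ ?_ ?_
  · refine hclose.trans (Finset.card_le_card fun m hm => ?_)
    rw [Finset.mem_filter] at hm ⊢
    exact ⟨hm.1, by rw [hm.2, neg_neg]⟩
  · intro h'
    exact hne (by rw [← neg_neg (ε m₁), h'])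
  · have : (∑ m ∈ range p, C (-ε m) * X ^ m) = -∑ m ∈ range p, C (ε m) * X ^ m := by
      rw [← Finset.sum_neg_distrib]
      refine Finset.sum_congr rfl fun m _ => ?_
      rw [map_neg, neg_mul]
    rw [this]
    exact (dvd_neg).mpr hdvd

end Extremiser

end Summit.ValiantsHypothesis.Theorems.FeketeNoSparseSplit.Negative
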